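import Literature.MathematicalPhysics.QuantumFieldTheory.Volkov2017.SumToMaxLemma
import Literature.MathematicalPhysics.QuantumFieldTheory.Volkov2017.FastSamplingTable
import Literature.MathematicalPhysics.QuantumFieldTheory.Borinsky2020.HeppSectorDecomposition
import HarnessLib

/-!
# Volkov's whole-simplex normaliser (PRD 96 §III.B–C): the `n!` sector densities (16) glue to ONE function `g₀` on the simplex, the sectors partition the `δ`-resolved chart up to null sets, and `∫_{z>0} g₀(z) δ(z₁+…+z_n − 1) dz = Σ_{a∈Λ} W(Λ∖{a})` — PROVED

independent recomputation; certified where stated, statistical where stated; no new-physics claim.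

CITATION HEADER (venture `QEDPrecision`, cell `pub-qed`, track TROPICAL seat V3a = `pub-qed-trop-v3-lit-1` gen 13; VALUE-FREE: a
measure-theoretic assembly in the symbols `Deg(s) > 0`; no constant, nothing per graph, per word or per Set V family). Third file of the
chain `FastSamplingTable.lean` (gen 8: the table `W`, (23), (24), the sector law `genProb`, the printed VALUES `sectorIntegral = 1/∏Deg` and
`totalW = Σ_a W(Λ∖{a})`, and the DISCRETE identity `sum_sectorIntegral : Σ_sectors 1/∏Deg = Σ_a W(Λ∖{a})`) → `SectorIntegral.lean` /
`SumToMaxLemma.lean` (gen 8 / gen 12: ONE sector — the affine-chart integral and then the `δ(Σz − 1)` integral of (16) over `S_{1,…,n}` equal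
`1/∏Deg`; listed there as NOT typed: "the sum of (19) over all `n!` sectors (`= Σ_{a∈Λ} W(Λ∖{a})`)"). This file types that sum: the whole
simplex in ONE chart, its partition into the `n!` sectors, the transport of each sector to `S_{1,…,n}`, and the printed sentence on the whole
integral as a single theorem. Serves `tropical/view/V3-VOLKOV-DEGREES.md` §A A.2.3 / A.19 / A.29–A.30 (item A.30.3 (a): "the whole-simplex
normaliser as ONE theorem").

Source [Volkov2017]: S. Volkov, "New method of computing the contributions of graphs without lepton loops to the electron anomalous magnetic
moment in QED", Phys. Rev. D 96, 096018 (2017) = arXiv:1705.05800v4 (e-print `amm4_mc_arxiv.tex` held on the cell's HOME under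
`data/lit/sources/.cache/1705.05800/`, sha256 3d5fd6a7…; equation numbers counted from the numbered `equation` environments, LaTeX labels
given; §III.B–C = arXiv PDF p.11 and p.16–18), VERBATIM:
* §III.B (tex l.565–569): "In this case, g must satisfy the condition ∫_{z₁,…,z_n>0} g(z₁,…,z_n) δ(z₁+…+z_n−1) dz₁…dz_n = 1."
* §III.B (tex l.572–583): "All the space ℝⁿ is split [footnote: Let us remark that the components has intersections on their boundaries.
  However, this is inessential for integration.] into sectors. Each sector corresponds to a permutation (j₁,…,j_n) of {1,2,…,n} and is
  defined by S_{j₁,…,j_n} = {(z₁,…,z_n) ∈ ℝ : z_{j₁} ≥ z_{j₂} ≥ … ≥ z_{j_n}}."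
* §III.B eq. (16) `eq_mc_g0` (tex l.584–593): "We define the function g₀(z₁,…,z_n) on S_{j₁,…,j_n} by the following relation
  g₀(z₁,…,z_n) = ∏_{l=2}^{n} (z_{j_l}/z_{j_{l−1}})^{Deg({j_l,j_{l+1},…,j_n})} / (z₁z₂…z_n), where Deg(s) > 0 is defined for each set s of
  internal lines of G except the empty set and the set of all internal lines of G. The probability density function is defined by
  g(z₁,…,z_n) = g₀(z₁,…,z_n) / ∫_{z₁,…,z_n>0} g₀(z₁,…,z_n) δ(z₁+…+z_n−1) dz₁…dz_n." (tex l.594–599)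
* §III.C (tex l.973–982; arXiv PDF p.18): "For calculating the probability density at a given point it is needed to know the whole integral
  ∫_{z₁,…,z_n>0} g₀(z₁,…,z_n) δ(z₁+…+z_n−1) dz₁…dz_n. It equals Σ_{a∈Λ} W(Λ∖{a})."  [W = the table of eq. (23) `eq_dyn_prog`,
  `FastSamplingTable.tableW`; Λ = {1,…,n}; "Generation of a sector. for l := 1 to n do put j_l = a with the probability
  P[Λ∖{j₁,…,j_{l−1}}, a]" (tex l.993–998) = `FastSamplingTable.genProb`.]

What is typed (all PROVED; Mathlib + the tree's `Volkov2017/SumToMaxLemma`, `Volkov2017/FastSamplingTable`, `Borinsky2020/HeppSectorDecomposition`).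
Conventions as in `SumToMaxLemma.lean`: `n = m + 2 ≥ 2` lines labelled `0, …, n−1` (Volkov's `1, …, n`), a point of `ℝⁿ` is `Fin (m + 2) → ℝ`,
the `δ(z₁+…+z_n − 1)` is resolved in the coordinate `z₁` (index `0`): the chart is `x = (z₂,…,z_n) ∈ ℝ^{n−1}` with `z = (1 − Σ x, x)`; a sector
`S_{j₁,…,j_n}` is the permutation `σ` with `σ (l−1) = j_l`, i.e. `z ∘ σ` DECREASING.
* §1 `simplexPoint x = (1 − Σ x, x)` (def; `simplexPoint_eq` is the literal `Fin.cons (1 - ∑ i, x i) x` of `SumToMaxLemma`), `sum_simplexPoint`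
  (`Σ z = 1`), `simplexPoint_tail` (every `Σ z = 1` point is a chart point); `simplexChart m = {x | z > 0}` (def) = `{x > 0, Σ x < 1}`
  (`mem_simplexChart_iff`) — the domain "z₁,…,z_n > 0" of the whole integral.
* §2 THE RELABELLINGS IN THE CHART. `chartPerm σ x = tail(z(x) ∘ σ)` (def) with **`simplexPoint_chartPerm : z(Φ_σ x) = z(x) ∘ σ`**, the action
  law `chartPerm_chartPerm` (`Φ_σ ∘ Φ_τ = Φ_{τσ}`), `chartPerm_one`; its affine structure `chartPerm_eq_lin_add` (`Φ_σ = L_σ + c_σ`, `liftLin`,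
  `chartPermLin`, `chartPermShift` defs), `chartPermLin_mul` / `chartPermLin_pow`, **`abs_det_chartPermLin : |det L_σ| = 1`** (finite order:
  `L_σ^{ord σ} = 1`), hence **`measurePreserving_chartPerm`** (relabelling the simplex coordinates costs no Jacobian in the `δ`-resolved chart —
  Mathlib `map_linearMap_addHaar_eq_smul_addHaar` + translation invariance) and the measurable bijection `chartPermEquiv σ` (inverse `Φ_{σ⁻¹}`).
* §3 THE SECTORS. `chartSector σ = Φ_σ ⁻¹' simplexSectorChart m` (def) with **`mem_chartSector_iff : x ∈ chartSector σ ↔ z(x) > 0 ∧ z(x) ∘ σ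
  decreasing`** (= `S_σ ∩ {z > 0}` read in the chart); `sectorPerm z = (Tuple.sort z) ∘ rev` (def: the decreasing sort) and
  `antitone_comp_sectorPerm`; **`iUnion_chartSector : ⋃_σ chartSector σ = simplexChart`** ("All the space … is split into sectors");
  `chartTies` (def: two equal coordinates of `z(x)`), **`volume_chartTies = 0`** (each `{z_i = z_j}` is a level set of a non-zero linear
  functional on `ℝ^{n−1}`: `volume_setOf_linearMap_eq`), `perm_eq_of_antitone` (off the ties the sector is unique — via
  `Borinsky2020.eq_of_mem_weylChamber_of_injective`), **`chartSector_inter_subset : σ ≠ τ → chartSector σ ∩ chartSector τ ⊆ chartTies`**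
  ("the components has intersections on their boundaries. However, this is inessential for integration"), and
  **`integral_simplexChart_eq_sum : ∫_{simplexChart} f = Σ_σ ∫_{chartSector σ} f`** for every `f` integrable on each sector
  (Mathlib `integral_iUnion_ae`), and `integrableOn_simplexChart_iff` (integrable on the simplex ↔ integrable on every sector: a
  whole-simplex mean or second moment is finite iff each sector's is).
* §4 ONE SECTOR. **`setIntegral_chartSector_eq : ∫_{chartSector σ} f(z(x)) dx = ∫_{simplexSectorChart} f(z(y) ∘ σ⁻¹) dy`** (transport by `Φ_σ`)
  and `integrableOn_chartSector_iff` (the same for integrability, landing — with `SumToMaxLemma.integrableOn_simplexSectorChart_iff` — every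
  sector's finiteness question on the unit box of sector variables);
  `tailDeg Deg σ i = Deg(σ '' {k ≥ i+1})` (def: the exponent `Deg({j_l,…,j_n})`, `l = i + 2`, carried by `z_{j_l}/z_{j_{l−1}}` in (16)),
  `tailDeg_pos` (tail sets are non-empty and proper, so the printed "Deg(s) > 0" applies); **`setIntegral_chartSector_g0`**: if `G` agrees with
  (16) of the sector `σ` — `G z = g0Fund (tailDeg Deg σ) (z ∘ σ)` — at every injective positive `z`, `Σ z = 1`, `z ∘ σ` decreasing, then
  `∫_{chartSector σ} G(z(x)) dx = ∏_i (tailDeg Deg σ i)⁻¹` ("(19) … equals 1/∏_{l=2}^{n} Deg({j_l,…,j_n})" for `S_{j₁,…,j_n}`, inside the global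
  chart; the last step is `SumToMaxLemma.integral_simplexSectorChart_g0Fund`).
* §5 THE SUM. `tailWeight_ofFn` / `sectorIntegral_ofFn` (`FastSamplingTable.sectorIntegral Deg [σ 0,…,σ (n−1)] = ∏_i (tailDeg Deg σ i)⁻¹`),
  `ofFn_mem_orderings`, **`sum_perm_eq_sum_orderings`** (the bijection permutations of `{0,…,n−1}` ↔ `Borinsky2020.orderings univ`,
  `σ ↦ [σ 0,…,σ (n−1)]`), `sum_prod_tailDeg_inv : Σ_σ ∏_i (tailDeg Deg σ i)⁻¹ = totalW Deg univ`; and the headline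
  **`integral_simplexChart_eq_totalW`**: under "Deg(s) > 0 for every non-empty proper s", for every `G` agreeing with (16) sector by sector
  (interiors suffice), `∫_{simplexChart} G(z(x)) dx = totalW Deg univ = Σ_{a∈Λ} W(Λ∖{a})` — THE PRINTED SENTENCE; `integral_simplexChart_eq_totalW'`
  (the same over the literal `{x > 0, Σ x < 1}` with `Fin.cons (1 - ∑ i, x i) x`); **`setIntegral_chartSector_div_totalW`**: the mass of the sector
  `σ` under `G/Σ_a W(Λ∖{a})` is `FastSamplingTable.genProb Deg univ [σ 0,…,σ (n−1)]` — "To generate sectors with correct probabilities" now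
  relates the loop of eqs. (23)–(24) to the CONTINUOUS density.
* §6 A CONCRETE `g₀`. `g0Simplex Deg z = g0Fund (tailDeg Deg σ(z)) (z ∘ σ(z))` (def, `σ(z) = sectorPerm z`); `comp_eq_of_antitone`,
  `image_Ici_succ_eq_filter` and **`g0Fund_tailDeg_eq_of_antitone`**: for positive `z` lying in two sectors the two formulas (16) give the same
  number (where the tail sets differ the rearrangement has a tie and the factor is `1^{Deg}`) — (16) IS single-valued on the sector boundaries,
  the content of the footnote; hence `g0Simplex_eq_of_antitone'` (`g0Simplex` is (16) of EVERY sector containing `z > 0`), `g0Simplex_pos`,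
  **`integral_simplexChart_g0Simplex = totalW Deg univ`**, **`integral_simplexChart_g0Simplex_div_totalW = 1`** ("g must satisfy the condition
  ∫ g δ(Σz − 1) dz = 1" for `g = g₀/Σ_a W(Λ∖{a})`), and `setIntegral_chartSector_g0Simplex_div_totalW = genProb`.
NOT typed here: the law of the point-generation step ("Generation part 2": that `(sector, r) ↦ t ↦ y ↦ z` pushes the uniform `r`'s forward to
the density `g` — the per-sector ingredients are `SectorIntegral` / `SumToMaxLemma` §6, the sector weights are `setIntegral_chartSector_div_totalW`,
the pushforward itself is not assembled); anything about `Deg` beyond positivity on non-empty proper subsets; `n = 1`.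
-/

namespace Literature.MathematicalPhysics.QuantumFieldTheory.Volkov2017

open MeasureTheory Set Real
open Borinsky2020

variable {m : ℕ}

/-! ### §1 The `δ`-resolved chart of the simplex: `x = (z₂,…,z_n) ↦ z = (1 − Σ x, x)` -/

/-- The point of the hyperplane `Σ z = 1` above the chart point `x = (z₂, …, z_n)`: `(1 − Σ x, x)` — the `δ(z₁+…+z_n−1)` of
(12)/(19) resolved in the FIRST coordinate `z₁`, as in `SumToMaxLemma.lean` (there written inline).
[cite: Volkov2017, §II.C eq. (12) `eq_feyn_param_integral` and §III.C eq. (19) `eq_g0_integral`] -/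
def simplexPoint (x : Fin (m + 1) → ℝ) : Fin (m + 2) → ℝ := Fin.cons (1 - ∑ i, x i) x

/-- Unfolding (the literal form used in `SumToMaxLemma.lean`). [cite: Volkov2017, §III.C eq. (19)] -/
theorem simplexPoint_eq (x : Fin (m + 1) → ℝ) :
    simplexPoint x = (Fin.cons (1 - ∑ i, x i) x : Fin (m + 2) → ℝ) := rfl

/-- `z₁ = 1 − Σ x`. [cite: Volkov2017, §III.C eq. (19)] -/
@[simp] theorem simplexPoint_zero (x : Fin (m + 1) → ℝ) : simplexPoint x 0 = 1 - ∑ i, x i := by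
  simp [simplexPoint]

/-- `z_{i+1} = x_i`. [cite: Volkov2017, §III.C eq. (19)] -/
@[simp] theorem simplexPoint_succ (x : Fin (m + 1) → ℝ) (i : Fin (m + 1)) : simplexPoint x i.succ = x i := by
  simp [simplexPoint]

/-- Dropping `z₁` recovers the chart point. [cite: Volkov2017, §III.C eq. (19)] -/
theorem tail_simplexPoint (x : Fin (m + 1) → ℝ) : Fin.tail (simplexPoint x) = x :=
  Fin.tail_cons _ _

/-- `Σ_j z_j = 1` on the chart (the support of `δ(z₁+…+z_n − 1)`). [cite: Volkov2017, §II.C eq. (12)] -/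
theorem sum_simplexPoint (x : Fin (m + 1) → ℝ) : ∑ j, simplexPoint x j = 1 := by
  rw [Fin.sum_univ_succ]
  simp [simplexPoint]

/-- Conversely every point with `Σ z = 1` is the chart point of its tail. [cite: Volkov2017, §II.C eq. (12)] -/
theorem simplexPoint_tail {w : Fin (m + 2) → ℝ} (hw : ∑ j, w j = 1) : simplexPoint (Fin.tail w) = w := by
  have h0 : 1 - ∑ i, Fin.tail w i = w 0 := by
    rw [Fin.sum_univ_succ] at hw
    simp only [Fin.tail]
    linarith
  rw [simplexPoint, h0]
  exact Fin.cons_self_tail w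

/-- **The open simplex in the chart**: `{x | every coordinate of (1 − Σ x, x) is > 0}` = the integration domain
"`z₁, …, z_n > 0`" of (12)/(19) with the `δ`-function resolved. [cite: Volkov2017, §II.C eq. (12) and §III.C (display after eq. (24),
"the whole integral ∫_{z>0} g₀ δ(z₁+…+z_n−1) dz")] -/
def simplexChart (m : ℕ) : Set (Fin (m + 1) → ℝ) := {x | ∀ j, 0 < simplexPoint x j}

/-- Membership, coordinates unfolded: all `x_i > 0` and `Σ x < 1`. [cite: Volkov2017, §II.C eq. (12)] -/
theorem mem_simplexChart_iff {x : Fin (m + 1) → ℝ} : x ∈ simplexChart m ↔ (∀ i, 0 < x i) ∧ ∑ i, x i < 1 := by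
  simp only [simplexChart, mem_setOf_eq, Fin.forall_fin_succ, simplexPoint_zero, simplexPoint_succ, sub_pos]
  exact and_comm

/-! ### §2 The coordinate permutations of `ℝⁿ` read in the chart: `Φ_σ`, an affine Lebesgue-preserving bijection of `ℝ^{n−1}` -/

/-- **The chart expression of the relabelling `z ↦ z ∘ σ`**: `Φ_σ(x) = tail((1 − Σ x, x) ∘ σ)` (permute the `n` simplex
coordinates, then drop the first one again). This is how the sector `S_{j₁,…,j_n}` of (19) is carried to the sector
`S_{1,…,n}` inside ONE chart of the whole simplex. [cite: Volkov2017, §III.B ("Each sector corresponds to a permutation (j₁,…,j_n) of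
{1,2,…,n}") and §III.C eq. (19)] -/
def chartPerm (σ : Equiv.Perm (Fin (m + 2))) (x : Fin (m + 1) → ℝ) : Fin (m + 1) → ℝ :=
  Fin.tail (simplexPoint x ∘ ⇑σ)

/-- The relabelling does not change `Σ z`. [cite: Volkov2017, §III.B (sectors ↔ permutations)] -/
theorem sum_comp_perm (w : Fin (m + 2) → ℝ) (σ : Equiv.Perm (Fin (m + 2))) : ∑ j, (w ∘ ⇑σ) j = ∑ j, w j :=
  Equiv.sum_comp σ w

/-- **`Φ_σ` IS the relabelling, read in the chart**: `(1 − Σ Φ_σ x, Φ_σ x) = (1 − Σ x, x) ∘ σ`.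
[cite: Volkov2017, §III.B (sectors ↔ permutations) and §III.C eq. (19)] -/
theorem simplexPoint_chartPerm (σ : Equiv.Perm (Fin (m + 2))) (x : Fin (m + 1) → ℝ) :
    simplexPoint (chartPerm σ x) = simplexPoint x ∘ ⇑σ :=
  simplexPoint_tail (by rw [sum_comp_perm, sum_simplexPoint])

/-- `Φ_1 = id`. [cite: Volkov2017, §III.B (sectors ↔ permutations)] -/
theorem chartPerm_one (x : Fin (m + 1) → ℝ) : chartPerm (1 : Equiv.Perm (Fin (m + 2))) x = x := by
  show Fin.tail (simplexPoint x ∘ id) = x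
  rw [Function.comp_id, tail_simplexPoint]

/-- **Action law** `Φ_σ ∘ Φ_τ = Φ_{τσ}` (relabel by `τ`, then by `σ`). [cite: Volkov2017, §III.B (sectors ↔ permutations)] -/
theorem chartPerm_chartPerm (σ τ : Equiv.Perm (Fin (m + 2))) (x : Fin (m + 1) → ℝ) :
    chartPerm σ (chartPerm τ x) = chartPerm (τ * σ) x := by
  show Fin.tail (simplexPoint (chartPerm τ x) ∘ ⇑σ) = Fin.tail (simplexPoint x ∘ ⇑(τ * σ))
  rw [simplexPoint_chartPerm, Equiv.Perm.coe_mul]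
  rfl

/-- The linear lift `v ↦ (−Σ v, v)` of the chart onto the hyperplane `Σ z = 0` (the linear part of `x ↦ (1 − Σ x, x)`).
[cite: Volkov2017, §III.C eq. (19) (the δ-resolved chart)] -/
noncomputable def liftLin (m : ℕ) : (Fin (m + 1) → ℝ) →ₗ[ℝ] (Fin (m + 2) → ℝ) where
  toFun v := Fin.cons (-∑ i, v i) v
  map_add' v w := by
    ext j
    refine Fin.cases ?_ (fun i => ?_) j
    · simp only [Fin.cons_zero, Pi.add_apply, Finset.sum_add_distrib, neg_add]
    · simp only [Fin.cons_succ, Pi.add_apply]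
  map_smul' c v := by
    ext j
    refine Fin.cases ?_ (fun i => ?_) j
    · simp only [Fin.cons_zero, Pi.smul_apply, smul_eq_mul, RingHom.id_apply, Finset.mul_sum, mul_neg]
    · simp only [Fin.cons_succ, Pi.smul_apply, smul_eq_mul, RingHom.id_apply]

/-- Unfolding: `liftLin v = (−Σ v, v)`. [cite: Volkov2017, §III.C eq. (19)] -/
theorem liftLin_apply (v : Fin (m + 1) → ℝ) : liftLin m v = Fin.cons (-∑ i, v i) v := rfl

/-- `Σ_j (liftLin v)_j = 0`. [cite: Volkov2017, §III.C eq. (19)] -/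
theorem sum_liftLin (v : Fin (m + 1) → ℝ) : ∑ j, liftLin m v j = 0 := by
  rw [liftLin_apply, Fin.sum_univ_succ]
  simp

/-- A point of the hyperplane `Σ w = 0` is the lift of its tail. [cite: Volkov2017, §III.C eq. (19)] -/
theorem liftLin_tail {w : Fin (m + 2) → ℝ} (hw : ∑ j, w j = 0) : liftLin m (Fin.tail w) = w := by
  have h0 : -∑ i, Fin.tail w i = w 0 := by
    rw [Fin.sum_univ_succ] at hw
    simp only [Fin.tail]
    linarith
  rw [liftLin_apply, h0]
  exact Fin.cons_self_tail w

/-- The chart point is the linear lift plus the vertex `e₁ = (1, 0, …, 0)`. [cite: Volkov2017, §III.C eq. (19)] -/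
theorem simplexPoint_eq_liftLin_add (x : Fin (m + 1) → ℝ) :
    simplexPoint x = liftLin m x + Pi.single 0 1 := by
  ext j
  refine Fin.cases ?_ (fun i => ?_) j
  · simp [liftLin_apply]
    ring
  · simp [liftLin_apply, Fin.succ_ne_zero]

/-- **The linear part `L_σ` of `Φ_σ`**: `v ↦ tail((−Σ v, v) ∘ σ)`. [cite: Volkov2017, §III.B (sectors ↔ permutations)] -/
noncomputable def chartPermLin (σ : Equiv.Perm (Fin (m + 2))) : (Fin (m + 1) → ℝ) →ₗ[ℝ] (Fin (m + 1) → ℝ) :=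
  (LinearMap.funLeft ℝ ℝ Fin.succ) ∘ₗ (LinearMap.funLeft ℝ ℝ ⇑σ) ∘ₗ liftLin m

/-- Unfolding `L_σ`. [cite: Volkov2017, §III.B (sectors ↔ permutations)] -/
theorem chartPermLin_apply (σ : Equiv.Perm (Fin (m + 2))) (v : Fin (m + 1) → ℝ) :
    chartPermLin σ v = Fin.tail (liftLin m v ∘ ⇑σ) := rfl

/-- The translation part `c_σ = tail(e₁ ∘ σ)` of `Φ_σ`. [cite: Volkov2017, §III.B (sectors ↔ permutations)] -/
def chartPermShift (σ : Equiv.Perm (Fin (m + 2))) : Fin (m + 1) → ℝ :=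
  Fin.tail ((Pi.single 0 1 : Fin (m + 2) → ℝ) ∘ ⇑σ)

/-- **`Φ_σ` is affine**: `Φ_σ x = L_σ x + c_σ`. [cite: Volkov2017, §III.B (sectors ↔ permutations)] -/
theorem chartPerm_eq_lin_add (σ : Equiv.Perm (Fin (m + 2))) (x : Fin (m + 1) → ℝ) :
    chartPerm σ x = chartPermLin σ x + chartPermShift σ := by
  funext k
  simp only [chartPerm, chartPermLin_apply, chartPermShift, simplexPoint_eq_liftLin_add, Fin.tail,
    Function.comp_apply, Pi.add_apply]

/-- `L_σ` lifts to the relabelling on the hyperplane `Σ = 0`: `(−Σ L_σ v, L_σ v) = (−Σ v, v) ∘ σ`.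
[cite: Volkov2017, §III.B (sectors ↔ permutations)] -/
theorem liftLin_chartPermLin (σ : Equiv.Perm (Fin (m + 2))) (v : Fin (m + 1) → ℝ) :
    liftLin m (chartPermLin σ v) = liftLin m v ∘ ⇑σ := by
  rw [chartPermLin_apply]
  exact liftLin_tail (by rw [sum_comp_perm, sum_liftLin])

/-- `L_1 = 1`. [cite: Volkov2017, §III.B (sectors ↔ permutations)] -/
theorem chartPermLin_one : chartPermLin (1 : Equiv.Perm (Fin (m + 2))) = 1 := by
  refine LinearMap.ext fun v => ?_
  show Fin.tail (liftLin m v ∘ id) = v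
  rw [Function.comp_id, liftLin_apply, Fin.tail_cons]

/-- Action law for the linear parts: `L_σ L_τ = L_{τσ}`. [cite: Volkov2017, §III.B (sectors ↔ permutations)] -/
theorem chartPermLin_mul (σ τ : Equiv.Perm (Fin (m + 2))) :
    chartPermLin σ * chartPermLin τ = chartPermLin (τ * σ) := by
  refine LinearMap.ext fun v => ?_
  show Fin.tail (liftLin m (chartPermLin τ v) ∘ ⇑σ) = Fin.tail (liftLin m v ∘ ⇑(τ * σ))
  rw [liftLin_chartPermLin, Equiv.Perm.coe_mul]
  rfl

/-- Powers: `L_σ^k = L_{σ^k}`. [cite: Volkov2017, §III.B (sectors ↔ permutations)] -/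
theorem chartPermLin_pow (σ : Equiv.Perm (Fin (m + 2))) (k : ℕ) : chartPermLin σ ^ k = chartPermLin (σ ^ k) := by
  induction k with
  | zero => rw [pow_zero, pow_zero, chartPermLin_one]
  | succ k ih => rw [pow_succ, ih, chartPermLin_mul, ← pow_succ']

/-- **`|det L_σ| = 1`**: `L_σ` has finite order (`σ^{ord σ} = 1`), so its determinant is a real root of unity.
[cite: Volkov2017, §III.B (sectors ↔ permutations)] -/
theorem abs_det_chartPermLin (σ : Equiv.Perm (Fin (m + 2))) : |LinearMap.det (chartPermLin σ)| = 1 := by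
  have hk : 0 < orderOf σ := orderOf_pos σ
  have h : LinearMap.det (chartPermLin σ) ^ orderOf σ = 1 := by
    rw [← map_pow, chartPermLin_pow, pow_orderOf_eq_one, chartPermLin_one, map_one]
  have h2 : |LinearMap.det (chartPermLin σ)| ^ orderOf σ = 1 := by
    rw [← abs_pow, h, abs_one]
  exact (pow_eq_one_iff_of_nonneg (abs_nonneg _) hk.ne').mp h2

/-- `L_σ` preserves Lebesgue measure on `ℝ^{n−1}` (`|det| = 1`). [cite: Volkov2017, §III.B (sectors ↔ permutations)] -/
theorem measurePreserving_chartPermLin (σ : Equiv.Perm (Fin (m + 2))) :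
    MeasurePreserving (chartPermLin σ) volume volume := by
  have hdet : LinearMap.det (chartPermLin σ) ≠ 0 := fun h => by
    have h1 := abs_det_chartPermLin σ
    rw [h, abs_zero] at h1
    exact zero_ne_one h1
  refine ⟨(chartPermLin σ).continuous_of_finiteDimensional.measurable, ?_⟩
  rw [Measure.map_linearMap_addHaar_eq_smul_addHaar volume hdet, abs_inv, abs_det_chartPermLin, inv_one,
    ENNReal.ofReal_one, one_smul]

/-- **`Φ_σ` preserves Lebesgue measure on the chart** (a translate of `L_σ`): relabelling the simplex coordinates costs no
Jacobian in the `δ`-resolved chart. [cite: Volkov2017, §III.B (sectors ↔ permutations) and §III.C eq. (19)] -/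
theorem measurePreserving_chartPerm (σ : Equiv.Perm (Fin (m + 2))) :
    MeasurePreserving (chartPerm σ) volume volume := by
  have h : chartPerm σ = (fun y => y + chartPermShift σ) ∘ ⇑(chartPermLin σ) :=
    funext fun x => chartPerm_eq_lin_add σ x
  rw [h]
  exact (measurePreserving_add_right volume (chartPermShift σ)).comp (measurePreserving_chartPermLin σ)

/-- `Φ_σ` as a measurable bijection of the chart with inverse `Φ_{σ⁻¹}`. [cite: Volkov2017, §III.B (sectors ↔ permutations)] -/
noncomputable def chartPermEquiv (σ : Equiv.Perm (Fin (m + 2))) : (Fin (m + 1) → ℝ) ≃ᵐ (Fin (m + 1) → ℝ) where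
  toFun := chartPerm σ
  invFun := chartPerm σ⁻¹
  left_inv x := by
    show chartPerm σ⁻¹ (chartPerm σ x) = x
    rw [chartPerm_chartPerm, mul_inv_cancel, chartPerm_one]
  right_inv x := by
    show chartPerm σ (chartPerm σ⁻¹ x) = x
    rw [chartPerm_chartPerm, inv_mul_cancel, chartPerm_one]
  measurable_toFun := (measurePreserving_chartPerm σ).measurable
  measurable_invFun := (measurePreserving_chartPerm σ⁻¹).measurable

/-- Unfolding the equivalence. [cite: Volkov2017, §III.B (sectors ↔ permutations)] -/
theorem coe_chartPermEquiv (σ : Equiv.Perm (Fin (m + 2))) : ⇑(chartPermEquiv σ) = chartPerm σ := rfl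

/-- `Φ_σ` (as an equivalence) preserves Lebesgue measure. [cite: Volkov2017, §III.B (sectors ↔ permutations)] -/
theorem measurePreserving_chartPermEquiv (σ : Equiv.Perm (Fin (m + 2))) :
    MeasurePreserving (chartPermEquiv σ) volume volume :=
  measurePreserving_chartPerm σ

/-! ### §3 The `n!` sectors of the simplex in the chart: cover, null overlaps, the sum over sectors -/

/-- **The sector `S_σ = {z_{σ(0)} ≥ z_{σ(1)} ≥ … ≥ z_{σ(n−1)}}` of the simplex, in the chart**: the preimage under `Φ_σ` of the
chart-sector `simplexSectorChart m` of `S_{1,…,n}` (`SumToMaxLemma.lean` §4). [cite: Volkov2017, §III.B ("S_{j₁,…,j_n} = {z :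
z_{j₁} ≥ z_{j₂} ≥ … ≥ z_{j_n}}") and §III.C eq. (19)] -/
def chartSector (σ : Equiv.Perm (Fin (m + 2))) : Set (Fin (m + 1) → ℝ) := chartPerm σ ⁻¹' simplexSectorChart m

/-- Membership: `x ∈ chartSector σ` iff `z = (1 − Σ x, x)` has positive coordinates and `z ∘ σ` is decreasing.
[cite: Volkov2017, §III.B (the sector S_{j₁,…,j_n})] -/
theorem mem_chartSector_iff {σ : Equiv.Perm (Fin (m + 2))} {x : Fin (m + 1) → ℝ} :
    x ∈ chartSector σ ↔ (∀ j, 0 < simplexPoint x j) ∧ Antitone (simplexPoint x ∘ ⇑σ) := by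
  change ((∀ j, 0 < simplexPoint (chartPerm σ x) j) ∧
      ∀ i : Fin (m + 1), simplexPoint (chartPerm σ x) i.succ ≤ simplexPoint (chartPerm σ x) (Fin.castSucc i)) ↔ _
  rw [simplexPoint_chartPerm, Fin.antitone_iff_succ_le]
  refine and_congr_left' ⟨fun h j => ?_, fun h j => h (σ j)⟩
  have := h (σ.symm j)
  simpa using this

/-- The sector of `σ = 1` is the chart-sector of `S_{1,…,n}` itself. [cite: Volkov2017, §III.C eq. (19)] -/
theorem chartSector_one : chartSector (1 : Equiv.Perm (Fin (m + 2))) = simplexSectorChart m := by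
  have h : chartPerm (1 : Equiv.Perm (Fin (m + 2))) = (id : (Fin (m + 1) → ℝ) → Fin (m + 1) → ℝ) :=
    funext chartPerm_one
  rw [chartSector, h, preimage_id]

/-- Each chart sector lies in the open simplex chart. [cite: Volkov2017, §III.B (the sector S_{j₁,…,j_n})] -/
theorem chartSector_subset (σ : Equiv.Perm (Fin (m + 2))) : chartSector σ ⊆ simplexChart m :=
  fun _ hx => (mem_chartSector_iff.mp hx).1

/-- `chartSector σ` is measurable. [cite: Volkov2017, §III.B (the sector S_{j₁,…,j_n})] -/
theorem measurableSet_chartSector (σ : Equiv.Perm (Fin (m + 2))) : MeasurableSet (chartSector (m := m) σ) :=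
  measurableSet_simplexSectorChart.preimage (measurePreserving_chartPerm σ).measurable

/-- **The decreasing-sort permutation of a point**: `σ(z) = (sort z) ∘ rev`, so that `z ∘ σ(z)` is decreasing — the sector
containing `z`. [cite: Volkov2017, §III.B (tex l.572–583: "All the space ℝⁿ is split into sectors. Each sector
corresponds to a permutation (j₁,…,j_n)")] -/
noncomputable def sectorPerm (z : Fin (m + 2) → ℝ) : Equiv.Perm (Fin (m + 2)) := Tuple.sort z * Fin.revPerm

/-- `z ∘ σ(z)` is decreasing. [cite: Volkov2017, §III.B (the sector S_{j₁,…,j_n})] -/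
theorem antitone_comp_sectorPerm (z : Fin (m + 2) → ℝ) : Antitone (z ∘ ⇑(sectorPerm z)) := by
  intro i j hij
  have h := Tuple.monotone_sort z (Fin.rev_le_rev.mpr hij)
  simpa [sectorPerm, Equiv.Perm.coe_mul] using h

/-- Decreasing rearrangements are Weyl-chamber memberships (`Borinsky2020.weylChamber`, increasing convention) of `σ ∘ rev`.
[cite: Volkov2017, §III.B (the sector S_{j₁,…,j_n})] -/
theorem mem_weylChamber_of_antitone {z : Fin (m + 2) → ℝ} {σ : Equiv.Perm (Fin (m + 2))} (hσ : Antitone (z ∘ ⇑σ)) :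
    z ∈ weylChamber (σ * Fin.revPerm) := by
  refine mem_weylChamber_iff_monotone.mpr fun i j hij => ?_
  show z (σ (Fin.rev i)) ≤ z (σ (Fin.rev j))
  exact hσ (Fin.rev_le_rev.mpr hij)

/-- **Off the ties a point lies in exactly one sector**: if `z` is injective and both `z ∘ σ` and `z ∘ τ` are decreasing then
`σ = τ`. [cite: Volkov2017, §III.B (tex l.572–583, the sectors S_{j₁,…,j_n})] -/
theorem perm_eq_of_antitone {z : Fin (m + 2) → ℝ} (hz : Function.Injective z) {σ τ : Equiv.Perm (Fin (m + 2))}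
    (hσ : Antitone (z ∘ ⇑σ)) (hτ : Antitone (z ∘ ⇑τ)) : σ = τ :=
  mul_right_cancel (eq_of_mem_weylChamber_of_injective hz (mem_weylChamber_of_antitone hσ)
    (mem_weylChamber_of_antitone hτ))

/-- In particular the decreasing-sort permutation of an injective `z` is THE `σ` with `z ∘ σ` decreasing.
[cite: Volkov2017, §III.B (the sector S_{j₁,…,j_n})] -/
theorem sectorPerm_eq_of_antitone {z : Fin (m + 2) → ℝ} (hz : Function.Injective z) {σ : Equiv.Perm (Fin (m + 2))}
    (hσ : Antitone (z ∘ ⇑σ)) : sectorPerm z = σ :=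
  perm_eq_of_antitone hz (antitone_comp_sectorPerm z) hσ

/-- Every point of the open simplex chart lies in the chart sector of its decreasing sort.
[cite: Volkov2017, §III.B (tex l.572–583: "All the space ℝⁿ is split into sectors")] -/
theorem mem_chartSector_sectorPerm {x : Fin (m + 1) → ℝ} (hx : x ∈ simplexChart m) :
    x ∈ chartSector (sectorPerm (simplexPoint x)) :=
  mem_chartSector_iff.mpr ⟨hx, antitone_comp_sectorPerm _⟩

/-- **The sectors cover the simplex**: `⋃_σ chartSector σ = simplexChart` — "All the space ℝⁿ is split into sectors".
[cite: Volkov2017, §III.B (tex l.572–583)] -/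
theorem iUnion_chartSector : (⋃ σ : Equiv.Perm (Fin (m + 2)), chartSector σ) = simplexChart m :=
  Subset.antisymm (iUnion_subset chartSector_subset) fun _ hx => mem_iUnion.mpr ⟨_, mem_chartSector_sectorPerm hx⟩

/-- The open simplex chart is measurable. [cite: Volkov2017, §II.C eq. (12)] -/
theorem measurableSet_simplexChart : MeasurableSet (simplexChart m) := by
  rw [← iUnion_chartSector]
  exact MeasurableSet.iUnion measurableSet_chartSector

/-- **The ties in the chart**: the points `x` whose simplex point `(1 − Σ x, x)` has two equal coordinates (the union of the
sector boundaries). [cite: Volkov2017, §III.B footnote (tex l.574–576: "the components has intersections on their boundaries")] -/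
def chartTies (m : ℕ) : Set (Fin (m + 1) → ℝ) := {x | ¬ Function.Injective (simplexPoint x)}

/-- A level set of a non-zero linear functional on `ℝ^k` is Lebesgue-null (a proper affine hyperplane).
[cite: Volkov2017, §III.B footnote (tex l.574–576: "the components has intersections on their boundaries. However, this is
inessential for integration")] -/
theorem volume_setOf_linearMap_eq {k : ℕ} (ℓ : (Fin k → ℝ) →ₗ[ℝ] ℝ) (hℓ : ℓ ≠ 0) (c : ℝ) :
    volume {x : Fin k → ℝ | ℓ x = c} = 0 := by
  obtain ⟨q, hq⟩ : ∃ q, ℓ q ≠ 0 := by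
    by_contra h
    exact hℓ (LinearMap.ext fun v => by simpa using not_exists.mp h v)
  set p : Fin k → ℝ := (c / ℓ q) • q with hp_def
  have hp : ℓ p = c := by
    rw [hp_def, map_smul, smul_eq_mul, div_mul_cancel₀ c hq]
  have hset : {x : Fin k → ℝ | ℓ x = c} = (fun x => x + (-p)) ⁻¹' (LinearMap.ker ℓ : Set (Fin k → ℝ)) := by
    ext x
    simp only [mem_setOf_eq, mem_preimage, SetLike.mem_coe, LinearMap.mem_ker, map_add, map_neg, hp]
    constructor
    · intro h
      rw [h, add_neg_cancel]
    · intro h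
      linarith
  rw [hset, measure_preimage_add_right]
  exact Measure.addHaar_submodule volume _ fun htop => hℓ (LinearMap.ker_eq_top.mp htop)

/-- **The ties are Lebesgue-null in the chart** (each `{z_i = z_j}` is a proper affine hyperplane of `ℝ^{n−1}`) — "the components has
intersections on their boundaries. However, this is inessential for integration". [cite: Volkov2017, §III.B footnote (tex l.574–576)] -/
theorem volume_chartTies : volume (chartTies m) = 0 := by
  have hties : chartTies m = ⋃ i : Fin (m + 2), ⋃ j : Fin (m + 2), ⋃ (_ : i ≠ j),
      {x : Fin (m + 1) → ℝ | simplexPoint x i = simplexPoint x j} := by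
    ext x
    simp only [chartTies, Function.Injective, mem_setOf_eq, mem_iUnion, not_forall, exists_prop]
    constructor
    · rintro ⟨a, b, hab, hne⟩
      exact ⟨a, b, hne, hab⟩
    · rintro ⟨a, b, hne, hab⟩
      exact ⟨a, b, hab, hne⟩
  rw [hties]
  refine measure_iUnion_null fun i => measure_iUnion_null fun j => measure_iUnion_null fun hij => ?_
  let ℓ : (Fin (m + 1) → ℝ) →ₗ[ℝ] ℝ :=
    (LinearMap.proj (R := ℝ) (φ := fun _ : Fin (m + 2) => ℝ) i -
      LinearMap.proj (R := ℝ) (φ := fun _ : Fin (m + 2) => ℝ) j) ∘ₗ liftLin m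
  have hℓapply : ∀ x, ℓ x = liftLin m x i - liftLin m x j := fun x => rfl
  have hset : {x : Fin (m + 1) → ℝ | simplexPoint x i = simplexPoint x j} =
      {x | ℓ x = (Pi.single 0 1 : Fin (m + 2) → ℝ) j - (Pi.single 0 1 : Fin (m + 2) → ℝ) i} := by
    ext x
    simp only [mem_setOf_eq, hℓapply, simplexPoint_eq_liftLin_add, Pi.add_apply]
    constructor
    · intro h
      linarith
    · intro h
      linarith
  have hℓ : ℓ ≠ 0 := by
    intro h0
    set w : Fin (m + 2) → ℝ := Pi.single i 1 - Pi.single j 1 with hw_def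
    have hw : ∑ l, w l = 0 := by
      simp [hw_def, Finset.sum_sub_distrib]
    have hv : liftLin m (Fin.tail w) = w := liftLin_tail hw
    have h1 : ℓ (Fin.tail w) = 0 := by rw [h0]; rfl
    rw [hℓapply, hv, hw_def] at h1
    simp [hij, hij.symm] at h1
  rw [hset]
  exact volume_setOf_linearMap_eq ℓ hℓ _

/-- **Two different sectors meet only in the ties.** [cite: Volkov2017, §III.B footnote (tex l.574–576: "the components has
intersections on their boundaries")] -/
theorem chartSector_inter_subset {σ τ : Equiv.Perm (Fin (m + 2))} (hστ : σ ≠ τ) :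
    chartSector σ ∩ chartSector τ ⊆ chartTies m := by
  rintro x ⟨hσ, hτ⟩ hinj
  exact hστ (perm_eq_of_antitone hinj (mem_chartSector_iff.mp hσ).2 (mem_chartSector_iff.mp hτ).2)

/-- **The simplex integral is the sum of the `n!` sector integrals** (cover + null overlaps), for every integrand integrable on each
sector. [cite: Volkov2017, §III.B (tex l.572–583 with the footnote l.574–576) and §III.C (the whole integral, display after eq. (24),
tex l.973–982)] -/
theorem integral_simplexChart_eq_sum {F : Type*} [NormedAddCommGroup F] [NormedSpace ℝ F]
    {f : (Fin (m + 1) → ℝ) → F} (hf : ∀ σ : Equiv.Perm (Fin (m + 2)), IntegrableOn f (chartSector σ)) :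
    ∫ x in simplexChart m, f x = ∑ σ : Equiv.Perm (Fin (m + 2)), ∫ x in chartSector σ, f x := by
  rw [← iUnion_chartSector, integral_iUnion_ae (fun σ => (measurableSet_chartSector σ).nullMeasurableSet)
      (fun σ τ hστ => measure_mono_null (chartSector_inter_subset hστ) volume_chartTies)
      (integrableOn_finite_iUnion.mpr hf), tsum_fintype]

/-- **Finiteness on the simplex is finiteness sector by sector**: `f` is integrable over the open simplex chart iff it is integrable
over each of the `n!` chart sectors (so a whole-simplex mean / second moment `∫ I²/g δ(Σz − 1) dz` is finite iff every sector's is).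
[cite: Volkov2017, §III.B (tex l.572–583 with the footnote l.574–576: the simplex is the union of the sectors up to boundaries)] -/
theorem integrableOn_simplexChart_iff {F : Type*} [NormedAddCommGroup F] {f : (Fin (m + 1) → ℝ) → F} :
    IntegrableOn f (simplexChart m) ↔ ∀ σ : Equiv.Perm (Fin (m + 2)), IntegrableOn f (chartSector σ) := by
  rw [← iUnion_chartSector]
  exact integrableOn_finite_iUnion

/-! ### §4 One sector: transport to `S_{1,…,n}` by `Φ_σ` and Volkov's evaluation `1/∏_l Deg` -/

/-- **Transport of a sector integral to the fundamental sector**: `∫_{chartSector σ} f(z(x)) dx = ∫_{S_{1,…,n}} f(z(y) ∘ σ⁻¹) dy`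
(`Φ_σ` is Lebesgue-preserving and maps `chartSector σ` onto the chart-sector of `S_{1,…,n}`). [cite: Volkov2017, §III.B–C (each
sector S_{j₁,…,j_n} is treated as S_{1,…,n} after relabelling the lines l ↦ j_l; eq. (16), eq. (19))] -/
theorem setIntegral_chartSector_eq {F : Type*} [NormedAddCommGroup F] [NormedSpace ℝ F]
    (σ : Equiv.Perm (Fin (m + 2))) (f : (Fin (m + 2) → ℝ) → F) :
    ∫ x in chartSector σ, f (simplexPoint x) = ∫ y in simplexSectorChart m, f (simplexPoint y ∘ ⇑σ⁻¹) := by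
  have h := (measurePreserving_chartPermEquiv σ).setIntegral_preimage_emb (chartPermEquiv σ).measurableEmbedding
    (fun y => f (simplexPoint y ∘ ⇑σ⁻¹)) (simplexSectorChart m)
  rw [coe_chartPermEquiv] at h
  rw [← h]
  refine setIntegral_congr_fun (measurableSet_chartSector σ) fun x _ => ?_
  rw [simplexPoint_chartPerm]
  congr 1
  ext j
  simp

/-- … and the matching integrability transport: `f(z(x))` is integrable over `chartSector σ` iff `f(z(y) ∘ σ⁻¹)` is integrable over the
chart-sector of `S_{1,…,n}` (with `SumToMaxLemma.integrableOn_simplexSectorChart_iff` this lands every sector's finiteness question on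
the unit box of sector variables). [cite: Volkov2017, §III.B–C (each sector treated as S_{1,…,n} after relabelling; eq. (19))] -/
theorem integrableOn_chartSector_iff {F : Type*} [NormedAddCommGroup F] (σ : Equiv.Perm (Fin (m + 2)))
    (f : (Fin (m + 2) → ℝ) → F) :
    IntegrableOn (fun x => f (simplexPoint x)) (chartSector σ) ↔
      IntegrableOn (fun y => f (simplexPoint y ∘ ⇑σ⁻¹)) (simplexSectorChart m) := by
  have h := (measurePreserving_chartPermEquiv σ).integrableOn_comp_preimage (chartPermEquiv σ).measurableEmbedding
    (f := fun y => f (simplexPoint y ∘ ⇑σ⁻¹)) (s := simplexSectorChart m)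
  rw [coe_chartPermEquiv] at h
  rw [← h]
  refine integrableOn_congr_fun (fun x _ => ?_) (measurableSet_chartSector σ)
  simp only [Function.comp_apply]
  rw [simplexPoint_chartPerm]
  congr 1
  ext j
  simp

/-- **Volkov's tail-set exponents of a sector**: for `σ = (j₁,…,j_n)` (0-based `σ i = j_{i+1}`) the ratio `z_{j_{l}}/z_{j_{l−1}}`,
`l = i + 2`, carries `Deg({j_l,…,j_n}) = Deg(σ '' {i+1,…,n−1})`. [cite: Volkov2017, §III.B eq. (16) `eq_mc_g0`
("∏_{l=2}^{n} (z_{j_l}/z_{j_{l−1}})^{Deg({j_l,j_{l+1},…,j_n})}")] -/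
def tailDeg (Deg : Finset (Fin (m + 2)) → ℝ) (σ : Equiv.Perm (Fin (m + 2))) (i : Fin (m + 1)) : ℝ :=
  Deg ((Finset.Ici i.succ).image ⇑σ)

/-- The tail sets are non-empty … [cite: Volkov2017, §III.B eq. (16) ("Deg(s) > 0 is defined for each set s … except the empty
set and the set of all internal lines")] -/
theorem image_Ici_succ_nonempty (σ : Equiv.Perm (Fin (m + 2))) (i : Fin (m + 1)) :
    ((Finset.Ici i.succ).image ⇑σ).Nonempty :=
  Finset.nonempty_Ici.image _

/-- … and proper (they miss `σ 0 = j₁`). [cite: Volkov2017, §III.B eq. (16) ("… except the empty set and the set of all internal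
lines")] -/
theorem image_Ici_succ_ssubset (σ : Equiv.Perm (Fin (m + 2))) (i : Fin (m + 1)) :
    (Finset.Ici i.succ).image ⇑σ ⊂ Finset.univ := by
  refine Finset.ssubset_univ_iff.mpr fun h => ?_
  have hmem : σ 0 ∈ (Finset.Ici i.succ).image ⇑σ := by
    rw [h]
    exact Finset.mem_univ _
  obtain ⟨k, hk, hk0⟩ := Finset.mem_image.mp hmem
  have hk' : k = 0 := σ.injective hk0
  rw [hk', Finset.mem_Ici] at hk
  exact absurd hk (not_le.mpr (Fin.succ_pos i))

/-- Under the printed hypothesis "Deg(s) > 0 for every non-empty proper s" all tail-set exponents are positive.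
[cite: Volkov2017, §III.B eq. (16)] -/
theorem tailDeg_pos {Deg : Finset (Fin (m + 2)) → ℝ}
    (hDeg : ∀ s : Finset (Fin (m + 2)), s.Nonempty → s ⊂ Finset.univ → 0 < Deg s)
    (σ : Equiv.Perm (Fin (m + 2))) (i : Fin (m + 1)) : 0 < tailDeg Deg σ i :=
  hDeg _ (image_Ici_succ_nonempty σ i) (image_Ici_succ_ssubset σ i)

/-- **The integral of (16) over ONE sector of the simplex, in the global chart**: if `G` agrees with Volkov's `g₀` of the sector
`S_σ` — `G(z) = ∏_i ((z∘σ)_{i+1}/(z∘σ)_i)^{Deg(tail set)} / ∏ z` — at every injective positive `z` with `Σ z = 1` and `z ∘ σ`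
decreasing (the interior of the sector; the boundary is null), then `∫_{chartSector σ} G(z(x)) dx = ∏_i Deg(tail set)⁻¹` —
"(19) … equals 1/∏_{l=2}^{n} Deg({j_l,…,j_n})" for the sector `S_{j₁,…,j_n}`, now INSIDE the single chart of the whole simplex
(transport by `Φ_σ` + `integral_simplexSectorChart_g0Fund`). [cite: Volkov2017, §III.B eq. (16) and §III.C (evaluation of eq. (19),
display after eq. (22))] -/
theorem setIntegral_chartSector_g0 {G : (Fin (m + 2) → ℝ) → ℝ} {Deg : Finset (Fin (m + 2)) → ℝ}
    (σ : Equiv.Perm (Fin (m + 2)))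
    (hG : ∀ z : Fin (m + 2) → ℝ, (∀ j, 0 < z j) → ∑ j, z j = 1 → Function.Injective z → Antitone (z ∘ ⇑σ) →
      G z = g0Fund (tailDeg Deg σ) (z ∘ ⇑σ))
    (hD : ∀ i, 0 < tailDeg Deg σ i) :
    ∫ x in chartSector σ, G (simplexPoint x) = ∏ i, (tailDeg Deg σ i)⁻¹ := by
  rw [setIntegral_chartSector_eq σ G, ← integral_simplexSectorChart_g0Fund (tailDeg Deg σ) hD]
  refine integral_congr_ae ?_
  have hN : ∀ᵐ y ∂(volume.restrict (simplexSectorChart m)), y ∉ chartTies m :=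
    ae_restrict_of_ae (measure_eq_zero_iff_ae_notMem.mp volume_chartTies)
  filter_upwards [ae_restrict_mem measurableSet_simplexSectorChart, hN] with y hy hyN
  rw [← chartSector_one] at hy
  obtain ⟨hpos, hanti⟩ := mem_chartSector_iff.mp hy
  have hinj : Function.Injective (simplexPoint y) := not_not.mp hyN
  have hu : (simplexPoint y ∘ ⇑σ⁻¹) ∘ ⇑σ = simplexPoint y := by
    ext j
    simp
  have hanti' : Antitone ((simplexPoint y ∘ ⇑σ⁻¹) ∘ ⇑σ) := by
    rw [hu]
    simpa using hanti
  rw [hG (simplexPoint y ∘ ⇑σ⁻¹) (fun j => hpos _) (by rw [sum_comp_perm, sum_simplexPoint])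
    (hinj.comp σ⁻¹.injective) hanti', hu]
  rfl

/-! ### §5 The sum over sectors: permutations ↔ orderings, `∏ Deg(tail sets)⁻¹ = sectorIntegral`, and the whole integral -/

/-- The element set of `List.ofFn f` is the image of `f`. (Plumbing.) [cite: Volkov2017, §III.C (sectors as permutations (j₁,…,j_n))] -/
theorem toFinset_ofFn {ι : Type*} [DecidableEq ι] {k : ℕ} (f : Fin k → ι) :
    (List.ofFn f).toFinset = Finset.univ.image f := by
  ext a
  simp [List.mem_ofFn]

/-- Tail index sets shift under `succ`: `σ '' {k ≥ i+1} = (σ ∘ succ) '' {k ≥ i}`. (Plumbing.) [cite: Volkov2017, §III.B eq. (16) (the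
tail sets {j_l,…,j_n})] -/
theorem image_Ici_succ {ι : Type*} [DecidableEq ι] {k : ℕ} (f : Fin (k + 2) → ι) (i : Fin (k + 1)) :
    (Finset.Ici i.succ).image f = (Finset.Ici i).image (fun j => f j.succ) := by
  ext a
  simp only [Finset.mem_image, Finset.mem_Ici]
  constructor
  · rintro ⟨j, hj, rfl⟩
    have hj0 : j ≠ 0 := fun h => by
      rw [h] at hj
      exact absurd hj (not_le.mpr (Fin.succ_pos i))
    obtain ⟨j', rfl⟩ := Fin.exists_succ_eq.mpr hj0
    exact ⟨j', Fin.succ_le_succ_iff.mp hj, rfl⟩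
  · rintro ⟨j', hj', rfl⟩
    exact ⟨j'.succ, Fin.succ_le_succ_iff.mpr hj', rfl⟩

/-- **Volkov's summand on a permutation list**: `tailWeight Deg [f 0, …, f k] = ∏_i Deg(f '' {j ≥ i})⁻¹` — one factor per tail set.
[cite: Volkov2017, §III.C (display before eq. (23): "1/∏_{l=1}^{|s|} Deg({j_l, j_{l+1}, …, j_{|s|}})")] -/
theorem tailWeight_ofFn {ι : Type*} [DecidableEq ι] (Deg : Finset ι → ℝ) :
    ∀ {k : ℕ} (f : Fin (k + 1) → ι), tailWeight Deg (List.ofFn f) = ∏ i : Fin (k + 1), (Deg ((Finset.Ici i).image f))⁻¹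
  | 0, f => by
    rw [List.ofFn_succ, List.ofFn_zero, tailWeight_cons, tailWeight_nil, Fin.prod_univ_one, one_div]
    exact congrArg (fun s => (Deg s)⁻¹) (by ext a; simp)
  | k + 1, f => by
    have h0 : Finset.Ici (0 : Fin (k + 2)) = Finset.univ := by
      ext j
      simp
    rw [List.ofFn_succ, tailWeight_cons, ← List.ofFn_succ, toFinset_ofFn]
    conv_rhs => rw [Fin.prod_univ_succ, h0]
    rw [tailWeight_ofFn Deg (fun i => f i.succ), div_eq_mul_inv, mul_comm]
    congr 1
    exact Finset.prod_congr rfl fun i _ => by rw [image_Ici_succ]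

/-- **The printed sector value, indexed by the permutation**: `sectorIntegral Deg [σ 0, …, σ (n−1)] = ∏_i Deg(σ '' {k ≥ i+1})⁻¹`
(`FastSamplingTable.sectorIntegral` is `1/∏_{l=2}^{n} Deg({j_l,…,j_n})`). [cite: Volkov2017, §III.C (display after eq. (22))] -/
theorem sectorIntegral_ofFn (Deg : Finset (Fin (m + 2)) → ℝ) (σ : Equiv.Perm (Fin (m + 2))) :
    sectorIntegral Deg (List.ofFn ⇑σ) = ∏ i, (tailDeg Deg σ i)⁻¹ := by
  rw [List.ofFn_succ, sectorIntegral_cons, tailWeight_ofFn]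
  refine Finset.prod_congr rfl fun i _ => ?_
  rw [tailDeg, image_Ici_succ]

/-- The list `[σ 0, …, σ (n−1)]` of a permutation is an ordering of `Λ = {0,…,n−1}` (`Borinsky2020.orderings`, on which
`FastSamplingTable` sums). [cite: Volkov2017, §III.B ("Each sector corresponds to a permutation (j₁,…,j_n) of {1,2,…,n}")] -/
theorem ofFn_mem_orderings (σ : Equiv.Perm (Fin (m + 2))) :
    List.ofFn ⇑σ ∈ orderings (Finset.univ : Finset (Fin (m + 2))) :=
  mem_orderings.mpr ⟨List.nodup_ofFn.mpr σ.injective,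
    by rw [toFinset_ofFn, Finset.image_univ_of_surjective σ.surjective]⟩

/-- **Permutations ↔ orderings**: summing a function of the sector over the permutations `σ` of `{0,…,n−1}` is summing it over
the orderings of `Λ` (the bijection `σ ↦ [σ 0, …, σ (n−1)]`). [cite: Volkov2017, §III.B ("Each sector corresponds to a permutation")
and §III.C (W as a sum over "j₁,…,j_{|s|} ∈ s are distinct")] -/
theorem sum_perm_eq_sum_orderings (φ : List (Fin (m + 2)) → ℝ) :
    ∑ σ : Equiv.Perm (Fin (m + 2)), φ (List.ofFn ⇑σ) =
      ∑ l ∈ orderings (Finset.univ : Finset (Fin (m + 2))), φ l := by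
  refine Finset.sum_nbij (fun σ : Equiv.Perm (Fin (m + 2)) => List.ofFn ⇑σ) (fun σ _ => ofFn_mem_orderings σ)
    (fun σ _ τ _ h => Equiv.ext (congrFun (List.ofFn_injective h))) (fun l hl => ?_) (fun σ _ => rfl)
  obtain ⟨hnd, hset⟩ := mem_orderings.mp (Finset.mem_coe.mp hl)
  have hlen : l.length = m + 2 := by
    rw [← List.toFinset_card_of_nodup hnd, hset, Finset.card_univ, Fintype.card_fin]
  let g : Fin (m + 2) → Fin (m + 2) := fun i => l.get (Fin.cast hlen.symm i)
  have hg : Function.Injective g := fun i j h => by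
    have h' := (List.nodup_iff_injective_get.mp hnd) h
    exact Fin.ext (by simpa using congrArg Fin.val h')
  refine ⟨Equiv.ofBijective g hg.bijective_of_finite, Finset.mem_coe.mpr (Finset.mem_univ _), ?_⟩
  show List.ofFn g = l
  apply List.ext_get
  · rw [List.length_ofFn, hlen]
  · intro i h1 h2
    rw [List.get_ofFn]
    rfl

/-- **Summed over all sectors, Volkov's sector values give the printed normaliser**: `Σ_σ ∏_i Deg(tail set)⁻¹ = Σ_{a∈Λ} W(Λ∖{a})`
(`FastSamplingTable.sum_sectorIntegral`, re-indexed by permutations). [cite: Volkov2017, §III.C (displays after eq. (22) and after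
eq. (24))] -/
theorem sum_prod_tailDeg_inv (Deg : Finset (Fin (m + 2)) → ℝ) :
    ∑ σ : Equiv.Perm (Fin (m + 2)), ∏ i, (tailDeg Deg σ i)⁻¹ = totalW Deg Finset.univ := by
  simp_rw [← sectorIntegral_ofFn Deg]
  rw [sum_perm_eq_sum_orderings (sectorIntegral Deg), sum_sectorIntegral Deg Finset.univ_nonempty]

/-- **VOLKOV'S WHOLE-SIMPLEX NORMALISER, AS ONE THEOREM.** Let `Deg(s) > 0` for every non-empty proper `s ⊆ Λ = {0,…,n−1}` and let
`G : ℝⁿ → ℝ` agree, on (the interior of) each sector `S_σ = {z_{σ(0)} ≥ … ≥ z_{σ(n−1)}}` of the open simplex, with the density (16)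
of that sector, `g₀(z) = ∏_{l=2}^{n} (z_{j_l}/z_{j_{l−1}})^{Deg({j_l,…,j_n})}/(z₁⋯z_n)`, `j_l = σ(l−1)`. Then
`∫_{z>0} G(z) δ(z₁+…+z_n − 1) dz = Σ_{a∈Λ} W(Λ∖{a})` — "For calculating the probability density at a given point it is needed to
know the whole integral ∫_{z>0} g₀(z₁,…,z_n) δ(z₁+…+z_n−1) dz₁…dz_n. It equals Σ_{a∈Λ} W(Λ∖{a})." Assembly: sector partition of
the chart (§3) + transport `Φ_σ` and the per-sector value `1/∏ Deg` (§4, `SumToMaxLemma`) + the discrete identity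
`Σ_sectors 1/∏Deg = Σ_a W(Λ∖{a})` (`FastSamplingTable.sum_sectorIntegral`). [cite: Volkov2017, §III.C (display after eq. (24)
`eq_next_prob`, tex l.973–982; arXiv PDF p.18)] -/
theorem integral_simplexChart_eq_totalW {G : (Fin (m + 2) → ℝ) → ℝ} {Deg : Finset (Fin (m + 2)) → ℝ}
    (hDeg : ∀ s : Finset (Fin (m + 2)), s.Nonempty → s ⊂ Finset.univ → 0 < Deg s)
    (hG : ∀ (σ : Equiv.Perm (Fin (m + 2))) (z : Fin (m + 2) → ℝ), (∀ j, 0 < z j) → ∑ j, z j = 1 →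
      Function.Injective z → Antitone (z ∘ ⇑σ) → G z = g0Fund (tailDeg Deg σ) (z ∘ ⇑σ)) :
    ∫ x in simplexChart m, G (simplexPoint x) = totalW Deg Finset.univ := by
  have hval : ∀ σ : Equiv.Perm (Fin (m + 2)), ∫ x in chartSector σ, G (simplexPoint x) = ∏ i, (tailDeg Deg σ i)⁻¹ :=
    fun σ => setIntegral_chartSector_g0 σ (hG σ) (tailDeg_pos hDeg σ)
  have hint : ∀ σ : Equiv.Perm (Fin (m + 2)), IntegrableOn (fun x => G (simplexPoint x)) (chartSector σ) := fun σ =>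
    Integrable.of_integral_ne_zero (by
      rw [hval σ]
      exact (Finset.prod_pos fun i _ => inv_pos.mpr (tailDeg_pos hDeg σ i)).ne')
  rw [integral_simplexChart_eq_sum hint]
  simp_rw [hval]
  exact sum_prod_tailDeg_inv Deg

/-- The same with the chart point written out, `∫_{x} G(1 − Σ x, x) dx` over `{x > 0, Σ x < 1}` (the literal form of
`SumToMaxLemma.lean`). [cite: Volkov2017, §III.C (display after eq. (24))] -/
theorem integral_simplexChart_eq_totalW' {G : (Fin (m + 2) → ℝ) → ℝ} {Deg : Finset (Fin (m + 2)) → ℝ}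
    (hDeg : ∀ s : Finset (Fin (m + 2)), s.Nonempty → s ⊂ Finset.univ → 0 < Deg s)
    (hG : ∀ (σ : Equiv.Perm (Fin (m + 2))) (z : Fin (m + 2) → ℝ), (∀ j, 0 < z j) → ∑ j, z j = 1 →
      Function.Injective z → Antitone (z ∘ ⇑σ) → G z = g0Fund (tailDeg Deg σ) (z ∘ ⇑σ)) :
    ∫ x in {x : Fin (m + 1) → ℝ | (∀ i, 0 < x i) ∧ ∑ i, x i < 1}, G (Fin.cons (1 - ∑ i, x i) x) =
      totalW Deg Finset.univ := by
  have hset : {x : Fin (m + 1) → ℝ | (∀ i, 0 < x i) ∧ ∑ i, x i < 1} = simplexChart m :=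
    Set.ext fun x => mem_simplexChart_iff.symm
  rw [hset]
  exact integral_simplexChart_eq_totalW hDeg hG

/-- **"Sectors with correct probabilities", for the continuous density**: the mass of the sector `S_σ` under `G/Σ_a W(Λ∖{a})` is
the probability `genProb` with which the generation loop of §III.C (eqs. (23)–(24), `FastSamplingTable.genProb`) outputs the sector
`[σ 0, …, σ (n−1)]`. [cite: Volkov2017, §III.C ("To generate sectors with correct probabilities it is required to know the value (19)",
eq. (24) `eq_next_prob`, "Generation part 1")] -/
theorem setIntegral_chartSector_div_totalW {G : (Fin (m + 2) → ℝ) → ℝ} {Deg : Finset (Fin (m + 2)) → ℝ}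
    (hDeg : ∀ s : Finset (Fin (m + 2)), s.Nonempty → s ⊂ Finset.univ → 0 < Deg s) (σ : Equiv.Perm (Fin (m + 2)))
    (hG : ∀ z : Fin (m + 2) → ℝ, (∀ j, 0 < z j) → ∑ j, z j = 1 → Function.Injective z → Antitone (z ∘ ⇑σ) →
      G z = g0Fund (tailDeg Deg σ) (z ∘ ⇑σ)) :
    (∫ x in chartSector σ, G (simplexPoint x)) / totalW Deg Finset.univ = genProb Deg Finset.univ (List.ofFn ⇑σ) := by
  rw [setIntegral_chartSector_g0 σ hG (tailDeg_pos hDeg σ), ← sectorIntegral_ofFn]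
  have hmem := ofFn_mem_orderings σ
  rw [List.ofFn_succ] at hmem ⊢
  exact (genProb_eq hDeg hmem).symm

/-! ### §6 A concrete `g₀` on the whole simplex (sector chosen by decreasing sort) and the normalised density -/

/-- **(16) on the whole open simplex**: at `z`, take the sector `σ(z)` sorting `z` decreasingly and evaluate that sector's `g₀`
(`SumToMaxLemma.g0Fund` with the tail-set exponents of `σ(z)`). On sector boundaries (a null set) this picks one of the adjacent
sectors. [cite: Volkov2017, §III.B eq. (16) `eq_mc_g0` ("We define the function g₀(z₁,…,z_n) on S_{j₁,…,j_n} by the following relation")] -/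
noncomputable def g0Simplex (Deg : Finset (Fin (m + 2)) → ℝ) (z : Fin (m + 2) → ℝ) : ℝ :=
  g0Fund (tailDeg Deg (sectorPerm z)) (z ∘ ⇑(sectorPerm z))

/-- Off the ties `g0Simplex` IS the sector formula (16) of whichever sector contains `z`. [cite: Volkov2017, §III.B eq. (16)] -/
theorem g0Simplex_eq_of_antitone {Deg : Finset (Fin (m + 2)) → ℝ} {z : Fin (m + 2) → ℝ} (hz : Function.Injective z)
    {σ : Equiv.Perm (Fin (m + 2))} (hσ : Antitone (z ∘ ⇑σ)) :
    g0Simplex Deg z = g0Fund (tailDeg Deg σ) (z ∘ ⇑σ) := by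
  rw [g0Simplex, sectorPerm_eq_of_antitone hz hσ]

/-- Two decreasing rearrangements of the same point coincide as tuples (ties included). [cite: Volkov2017, §III.B (the sectors
S_{j₁,…,j_n}; a boundary point lies in several sectors)] -/
theorem comp_eq_of_antitone {z : Fin (m + 2) → ℝ} {σ τ : Equiv.Perm (Fin (m + 2))}
    (hσ : Antitone (z ∘ ⇑σ)) (hτ : Antitone (z ∘ ⇑τ)) : z ∘ ⇑σ = z ∘ ⇑τ := by
  have h := Tuple.unique_monotone (mem_weylChamber_iff_monotone.mp (mem_weylChamber_of_antitone hσ))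
    (mem_weylChamber_iff_monotone.mp (mem_weylChamber_of_antitone hτ))
  funext i
  have hi := congrFun h (Fin.rev i)
  simpa [Equiv.Perm.coe_mul] using hi

/-- At a STRICT drop of the decreasing rearrangement the tail set is intrinsic: `σ '' {k ≥ i+1} = {a | z_a ≤ (z∘σ)_{i+1}}`.
[cite: Volkov2017, §III.B eq. (16) (the tail sets {j_l,…,j_n} of a sector)] -/
theorem image_Ici_succ_eq_filter {z : Fin (m + 2) → ℝ} {σ : Equiv.Perm (Fin (m + 2))} (hσ : Antitone (z ∘ ⇑σ))
    {i : Fin (m + 1)} (hlt : z (σ i.succ) < z (σ (Fin.castSucc i))) :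
    (Finset.Ici i.succ).image ⇑σ = Finset.univ.filter (fun a => z a ≤ z (σ i.succ)) := by
  ext a
  simp only [Finset.mem_image, Finset.mem_Ici, Finset.mem_filter, Finset.mem_univ, true_and]
  constructor
  · rintro ⟨k, hk, rfl⟩
    exact hσ hk
  · intro ha
    refine ⟨σ.symm a, ?_, σ.apply_symm_apply a⟩
    by_contra hlt'
    have hle : σ.symm a ≤ Fin.castSucc i := Fin.le_castSucc_iff.mpr (not_le.mp hlt')
    have h := hσ hle
    simp only [Function.comp_apply, Equiv.apply_symm_apply] at h
    linarith

/-- **(16) is single-valued on sector boundaries**: if a positive `z` lies in two sectors (`z ∘ σ` and `z ∘ τ` both decreasing)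
then the two sector formulas give the same number — where the tail sets of `σ` and `τ` differ, the rearrangement has a tie and the
corresponding factor is `1^{Deg} = 1`. So "We define the function g₀(z₁,…,z_n) on S_{j₁,…,j_n} by (16)" defines ONE function on the
open orthant. [cite: Volkov2017, §III.B eq. (16) `eq_mc_g0`] -/
theorem g0Fund_tailDeg_eq_of_antitone (Deg : Finset (Fin (m + 2)) → ℝ) {z : Fin (m + 2) → ℝ} (hz : ∀ j, 0 < z j)
    {σ τ : Equiv.Perm (Fin (m + 2))} (hσ : Antitone (z ∘ ⇑σ)) (hτ : Antitone (z ∘ ⇑τ)) :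
    g0Fund (tailDeg Deg σ) (z ∘ ⇑σ) = g0Fund (tailDeg Deg τ) (z ∘ ⇑τ) := by
  have hw : z ∘ ⇑σ = z ∘ ⇑τ := comp_eq_of_antitone hσ hτ
  unfold g0Fund
  rw [hw]
  congr 1
  refine Finset.prod_congr rfl fun i _ => ?_
  by_cases h : z (τ i.succ) < z (τ (Fin.castSucc i))
  · -- a strict drop: the two tail sets are the same intrinsic set
    have hσi : z (σ i.succ) < z (σ (Fin.castSucc i)) := by
      have h1 := congrFun hw i.succ
      have h2 := congrFun hw (Fin.castSucc i)
      simp only [Function.comp_apply] at h1 h2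
      rw [h1, h2]
      exact h
    have h1 : z (σ i.succ) = z (τ i.succ) := by simpa using congrFun hw i.succ
    simp only [tailDeg]
    rw [image_Ici_succ_eq_filter hσ hσi, image_Ici_succ_eq_filter hτ h, h1]
  · -- a tie: the factor is 1 for either exponent
    have heq : z (τ i.succ) = z (τ (Fin.castSucc i)) :=
      le_antisymm (hτ (Fin.castSucc_lt_succ (i := i)).le) (not_lt.mp h)
    simp only [Function.comp_apply]
    rw [heq, div_self (hz _).ne', Real.one_rpow, Real.one_rpow]

/-- Consequently `g0Simplex` IS the sector formula (16) of EVERY sector containing the positive point `z` (no injectivity needed).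
[cite: Volkov2017, §III.B eq. (16) `eq_mc_g0`] -/
theorem g0Simplex_eq_of_antitone' {Deg : Finset (Fin (m + 2)) → ℝ} {z : Fin (m + 2) → ℝ} (hz : ∀ j, 0 < z j)
    {σ : Equiv.Perm (Fin (m + 2))} (hσ : Antitone (z ∘ ⇑σ)) :
    g0Simplex Deg z = g0Fund (tailDeg Deg σ) (z ∘ ⇑σ) :=
  g0Fund_tailDeg_eq_of_antitone Deg hz (antitone_comp_sectorPerm z) hσ

/-- `g₀ > 0` on the open orthant (every sector formula is a ratio of positive products). [cite: Volkov2017, §III.B eq. (16)] -/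
theorem g0Fund_pos (D : Fin (m + 1) → ℝ) {z : Fin (m + 2) → ℝ} (hz : ∀ j, 0 < z j) : 0 < g0Fund D z :=
  div_pos (Finset.prod_pos fun _ _ => Real.rpow_pos_of_pos (div_pos (hz _) (hz _)) _)
    (Finset.prod_pos fun _ _ => hz _)

/-- `g0Simplex > 0` on the open orthant. [cite: Volkov2017, §III.B eq. (16)] -/
theorem g0Simplex_pos (Deg : Finset (Fin (m + 2)) → ℝ) {z : Fin (m + 2) → ℝ} (hz : ∀ j, 0 < z j) :
    0 < g0Simplex Deg z :=
  g0Fund_pos _ fun _ => hz _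

/-- **The whole integral of the concrete `g₀`**: `∫_{z>0} g₀ δ(Σz − 1) dz = Σ_{a∈Λ} W(Λ∖{a})`.
[cite: Volkov2017, §III.C (display after eq. (24), tex l.973–982)] -/
theorem integral_simplexChart_g0Simplex {Deg : Finset (Fin (m + 2)) → ℝ}
    (hDeg : ∀ s : Finset (Fin (m + 2)), s.Nonempty → s ⊂ Finset.univ → 0 < Deg s) :
    ∫ x in simplexChart m, g0Simplex Deg (simplexPoint x) = totalW Deg Finset.univ :=
  integral_simplexChart_eq_totalW hDeg fun _ _ _ _ hz hσ => g0Simplex_eq_of_antitone hz hσ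

/-- **The sampling density** "`g = g₀/∫g₀`" with the printed normaliser: `g0Simplex/Σ_a W(Λ∖{a})` integrates to `1` over the simplex —
"For calculating the probability density at a given point it is needed to know the whole integral … It equals Σ_{a∈Λ} W(Λ∖{a})".
[cite: Volkov2017, §III.A–C (g = g₀ normalised; display after eq. (24))] -/
theorem integral_simplexChart_g0Simplex_div_totalW {Deg : Finset (Fin (m + 2)) → ℝ}
    (hDeg : ∀ s : Finset (Fin (m + 2)), s.Nonempty → s ⊂ Finset.univ → 0 < Deg s) :
    ∫ x in simplexChart m, g0Simplex Deg (simplexPoint x) / totalW Deg Finset.univ = 1 := by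
  rw [integral_div, integral_simplexChart_g0Simplex hDeg, div_self (totalW_pos Finset.univ_nonempty hDeg).ne']

/-- **The sector law of the density = the sector law of the loop**: the mass of `S_σ` under `g0Simplex/Σ_a W(Λ∖{a})` is
`genProb Deg Λ [σ 0,…,σ (n−1)]`. [cite: Volkov2017, §III.C ("To generate sectors with correct probabilities", eq. (24), "Generation
part 1")] -/
theorem setIntegral_chartSector_g0Simplex_div_totalW {Deg : Finset (Fin (m + 2)) → ℝ}
    (hDeg : ∀ s : Finset (Fin (m + 2)), s.Nonempty → s ⊂ Finset.univ → 0 < Deg s) (σ : Equiv.Perm (Fin (m + 2))) :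
    (∫ x in chartSector σ, g0Simplex Deg (simplexPoint x)) / totalW Deg Finset.univ =
      genProb Deg Finset.univ (List.ofFn ⇑σ) :=
  setIntegral_chartSector_div_totalW hDeg σ fun _ _ _ hz hσ => g0Simplex_eq_of_antitone hz hσ

end Literature.MathematicalPhysics.QuantumFieldTheory.Volkov2017
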